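import Mathlib.Algebra.Module.CharacterModule
import Mathlib.Analysis.SpecialFunctions.Complex.Circle
import Mathlib.LinearAlgebra.LinearIndependent.Basic
import Mathlib.MeasureTheory.Function.LocallyIntegrable
import Mathlib.MeasureTheory.Group.Measure
import Mathlib.MeasureTheory.Integral.Bochner.Set
import Mathlib.Topology.LocallyConstant.Basic
import Literature.GroupTheory.FiniteAbelian.CharacterModuleUnitAddCircle   -- ★ `ℚ/ℤ ↪ ℝ/ℤ` (`exists_addMonoidHom_ratAddCircle_unitAddCircle`)
import HarnessLib

/-!
# Unitary characters separate points, finitely supported functions, and functions invariant under a compact open subgroup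
# (Hewitt–Ross I, Thm. (22.17) «sufficiently many characters», Thm. (23.11) «Fourier uniqueness on `L¹`»; brick F3 «TORUS-FOURIER-UNIQ» of road (D), line LH6, crux H413)

Topic `MeasureTheory/Group`; namespace `Literature.MeasureTheory.Group`.  THEOREMS ONLY (no definition, no instance, no notation, no named fact, no `sorry`);
GENERIC (no `U(3)` token), Mathlib + one ★ glue lemma (`ℚ/ℤ ↪ ℝ/ℤ`).  Cell `pub/hodgecm-mathlib`, F0∕P3c∕P3b line LH6 «StCharTS», road (D) «DEEP-FL» interface v2
(LH6-p04 (g2), `F0/P3b/LH6-p04/g2/ROAD-D.interface.v2.txt` :24–:27, brick **F3 «TORUS-FOURIER-UNIQ»**), taken by the free hand LH10-p02 (g2) 2026-09-02T04:37Z; lane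
`--supports stmt-HodgeConjecture-24833`.  HONEST LABEL: HC_CM is proved only modulo the 7 printed citations (2 remaining: hLiu418 = stmt-HodgeConjecture-24832, h413 =
stmt-HodgeConjecture-24833) until rung 0 closes; this file is generic harmonic analysis and pays no printed statement — it is the uniqueness input of D3-ii
«SHELL-ORBITAL»: two functions on the split torus `M` of `U(Φ₃)(L⁺_v)`, invariant under the compact open `M ∩ K_N` and compactly supported, with the same pairing
against every character, coincide.

THE MATHEMATICS.  (§1) For an abelian group `A` and `a ≠ 1` there is a UNITARY character `χ : A →* S¹ ⊂ ℂˣ` with `χ a ≠ 1`: `ℚ/ℤ` is an injective cogenerator of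
abelian groups (Mathlib `CharacterModule.exists_character_apply_ne_zero_of_ne_zero`), and `ℚ/ℤ ↪ ℝ/ℤ ≅ S¹` (`q ↦ e^{2πiq}`) — the discrete case of [HewittRoss1979,
Thm. (22.17)].  (§2) Hence the evaluations `a ↦ (χ ↦ χ(a))` are pairwise DISTINCT characters of the group `Â = Hom(A, S¹)`, so by Dedekind's independence of characters
(Mathlib `linearIndependent_monoidHom`) a finitely supported `d : A → ℂ` with `∑_a χ(a)·d(a) = 0` for every unitary `χ` vanishes — Fourier uniqueness on a discrete
abelian group [HewittRoss1979, Thm. (23.11)].  (§3) If `T` is an abelian topological group, `C ≤ T` a compact open subgroup and `μ` a left-invariant measure, positive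
on opens and finite on compacts, then a `C`-invariant compactly supported `Ψ : T → ℂ` descends to a finitely supported `d` on `A = T ⧸ C`, and for a character `χ` of
`T` trivial on `C`, `∫ χ·Ψ dμ = μ(C) · ∑_{q} χ(q) d(q)`; since `0 < μ(C) < ∞`, two such functions with the same character integrals (unitary continuous characters
trivial on `C` suffice) are EQUAL.

* §1 `exists_monoidHom_circle_apply_ne_one`, `exists_unitary_monoidHom_apply_ne_one` — unitary characters separate points; `exists_unitary_monoidHom_apply_ne`
  (two points), `exists_unitary_monoidHom_apply_ne_of_quotient` (two classes mod `C`, by characters trivial on `C`) — the separation hypotheses of the Summits-side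
  twin ★ `Theorems/F0P3cStCharTSCharSeparation` (LH6-p04, p849214), discharged.
* §2 `eq_zero_of_forall_sum_char_mul_eq_zero`, `eq_of_forall_sum_char_mul_eq` — character sums separate finitely supported functions.
* §3 `isLocallyConstant_of_forall_mul_mem_eq` (invariance under an open subgroup ⇒ locally constant), `eq_of_forall_integral_char_mul_eq` (F3 «TORUS-FOURIER-UNIQ»).

## References
* [HewittRoss1979] E. Hewitt, K. A. Ross, *Abstract Harmonic Analysis I*, 2nd ed., Springer (1979): Thm. (22.17) (a locally compact abelian group admits sufficiently
  many continuous characters), Thm. (23.11) (a non-zero `μ ∈ M_a(G)` has `μ̂(χ) ≠ 0` for some character `χ`).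
* [Brown1982] K. S. Brown, *Cohomology of Groups*, GTM 87: Chap. III §4 (4.3) (`ℚ/ℤ`-characters separate points) — through Mathlib `CharacterModule`.
-/

set_option autoImplicit false

noncomputable section

open MeasureTheory MeasureTheory.Measure Topology Set

namespace Literature.MeasureTheory.Group

/-! ### §1 Unitary characters of an abelian group separate points -/

section Separate

variable {A : Type*} [CommGroup A]

/-- **UNITARY CHARACTERS SEPARATE POINTS (circle-valued).**  For `a ≠ 1` in an abelian group there is `χ : A →* S¹` with `χ a ≠ 1`: a `ℚ/ℤ`-character of
`Additive A` not vanishing at `a` (Mathlib `CharacterModule.exists_character_apply_ne_zero_of_ne_zero`), pushed through `ℚ/ℤ ↪ ℝ/ℤ` (★) and `ℝ/ℤ ≅ S¹`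
(`AddCircle.toCircle`, injective). [cite: HewittRoss1979, Thm. (22.17)] [cite: Brown1982, Chap. III §4 (4.3)] -/
theorem exists_monoidHom_circle_apply_ne_one {a : A} (ha : a ≠ 1) : ∃ χ : A →* Circle, χ a ≠ 1 := by
  have ha' : (Additive.ofMul a : Additive A) ≠ 0 := ha
  obtain ⟨c, hc⟩ := CharacterModule.exists_character_apply_ne_zero_of_ne_zero ha'
  obtain ⟨ι, -, hιinj, -⟩ :=
    Literature.GroupTheory.FiniteAbelian.exists_addMonoidHom_ratAddCircle_unitAddCircle
  let χ : A →* Circle :=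
    { toFun := fun x => AddCircle.toCircle (ι (c (Additive.ofMul x))),
      map_one' := by simp only [ofMul_one, map_zero, AddCircle.toCircle_zero],
      map_mul' := fun x y => by simp only [ofMul_mul, map_add, AddCircle.toCircle_add] }
  refine ⟨χ, fun h1 => hc ?_⟩
  change AddCircle.toCircle (ι (c (Additive.ofMul a))) = 1 at h1
  have h2 : ι (c (Additive.ofMul a)) = 0 :=
    AddCircle.injective_toCircle one_ne_zero (h1.trans AddCircle.toCircle_zero.symm)
  exact hιinj (h2.trans (map_zero ι).symm)

/-- **UNITARY CHARACTERS SEPARATE POINTS (`ℂˣ`-valued, with `|χ| = 1`).** [cite: HewittRoss1979, Thm. (22.17)] -/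
theorem exists_unitary_monoidHom_apply_ne_one {a : A} (ha : a ≠ 1) :
    ∃ χ : A →* ℂˣ, (∀ b, ‖((χ b : ℂˣ) : ℂ)‖ = 1) ∧ χ a ≠ 1 := by
  obtain ⟨χ, hχ⟩ := exists_monoidHom_circle_apply_ne_one ha
  refine ⟨Circle.toUnits.comp χ, fun b => ?_, fun h => hχ ?_⟩
  · rw [MonoidHom.comp_apply, Circle.toUnits_apply, Units.val_mk0]
    exact Circle.norm_coe _
  · have h' : ((Circle.toUnits (χ a) : ℂˣ) : ℂ) = 1 := by
      rw [MonoidHom.comp_apply] at h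
      rw [h, Units.val_one]
    rw [Circle.toUnits_apply, Units.val_mk0] at h'
    exact Circle.coe_eq_one.mp h'

/-- **UNITARY CHARACTERS SEPARATE ANY TWO POINTS**: `a ≠ a'` ⇒ some unitary `χ : A →* ℂˣ` has `χ a ≠ χ a'` (§1 at `a·a'⁻¹`).  This is the «characters separate the
points of `S`» hypothesis of the Summits-side twin ★ `F0P3cStCharTSCharSeparation.eq_zero_of_forall_sum_mul_char_eq_zero` (LH6-p04, p849214), discharged for every
commutative group. [cite: HewittRoss1979, Thm. (22.17)] -/
theorem exists_unitary_monoidHom_apply_ne {a a' : A} (h : a ≠ a') :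
    ∃ χ : A →* ℂˣ, (∀ b, ‖((χ b : ℂˣ) : ℂ)‖ = 1) ∧ χ a ≠ χ a' := by
  have h1 : a * a'⁻¹ ≠ 1 := by rwa [Ne, mul_inv_eq_one]
  obtain ⟨χ, hχu, hχ⟩ := exists_unitary_monoidHom_apply_ne_one h1
  refine ⟨χ, hχu, fun heq => hχ ?_⟩
  rw [map_mul, map_inv, heq, mul_inv_cancel]

/-- **… AND ANY TWO CLASSES MODULO A SUBGROUP, BY CHARACTERS TRIVIAL ON IT**: if `s⁻¹·s' ∉ C` there is a unitary character `χ : T →* ℂˣ` with `C ≤ ker χ` and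
`χ s ≠ χ s'` (§1 on the quotient group `T ⧸ C`).  Discharges the separation hypothesis of the Summits-side quotient form ★
`F0P3cStCharTSCharSeparation.eq_zero_of_forall_sum_mul_char_eq_zero_quotient`. [cite: HewittRoss1979, Thm. (22.17)] -/
theorem exists_unitary_monoidHom_apply_ne_of_quotient {T : Type*} [CommGroup T] (C : Subgroup T) {s s' : T} (h : s⁻¹ * s' ∉ C) :
    ∃ χ : T →* ℂˣ, (∀ c ∈ C, χ c = 1) ∧ (∀ t, ‖((χ t : ℂˣ) : ℂ)‖ = 1) ∧ χ s ≠ χ s' := by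
  have hne : (QuotientGroup.mk' C s) ≠ QuotientGroup.mk' C s' := fun heq => h (QuotientGroup.eq.mp heq)
  obtain ⟨χq, hχu, hχ⟩ := exists_unitary_monoidHom_apply_ne hne
  refine ⟨χq.comp (QuotientGroup.mk' C), fun c hc => ?_, fun t => hχu _, fun heq => hχ ?_⟩
  · rw [MonoidHom.comp_apply, QuotientGroup.mk'_apply, (QuotientGroup.eq_one_iff c).mpr hc, map_one]
  · simpa only [MonoidHom.comp_apply] using heq

end Separate

/-! ### §2 Character sums separate finitely supported functions on an abelian group -/

section Finsupp

variable {A : Type*} [CommGroup A]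

/-- **FOURIER UNIQUENESS ON A DISCRETE ABELIAN GROUP.**  If `d : A → ℂ` is supported in the finite set `S` and `∑_{a ∈ S} χ(a)·d(a) = 0` for every UNITARY
character `χ : A →* ℂˣ`, then `d = 0`.  Proof: the evaluations `a ↦ (χ ↦ χ(a))` are characters of the group `Hom(A, S¹)`, pairwise distinct by §1, hence linearly
independent over `ℂ` (Dedekind, Mathlib `linearIndependent_monoidHom`); the hypothesis is a vanishing linear combination of them.  (Hypothesis-free, UNITARY-family
form living in `Literature/`; the Summits-side twin under an explicit separation hypothesis and for all `ℂˣ`-valued characters is ★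
`F0P3cStCharTSCharSeparation.eq_zero_of_forall_sum_mul_char_eq_zero` (LH6-p04, p849214) — its hypothesis is §1's `exists_unitary_monoidHom_apply_ne`.)
[cite: HewittRoss1979, Thm. (23.11)] -/
theorem eq_zero_of_forall_sum_char_mul_eq_zero (d : A → ℂ) (S : Finset A) (hS : Function.support d ⊆ (S : Set A))
    (h : ∀ χ : A →* ℂˣ, (∀ b, ‖((χ b : ℂˣ) : ℂ)‖ = 1) → ∑ a ∈ S, ((χ a : ℂˣ) : ℂ) * d a = 0) :
    d = 0 := by
  classical
  -- the evaluation characters of `X := Hom(A, S¹)`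
  let e : A → ((A →* Circle) →* ℂ) := fun a =>
    { toFun := fun χ => ((χ a : Circle) : ℂ)
      map_one' := by simp
      map_mul' := fun χ₁ χ₂ => by simp }
  have he : Function.Injective e := by
    intro a b hab
    by_contra hne
    have hne' : a * b⁻¹ ≠ 1 := by rwa [Ne, mul_inv_eq_one]
    obtain ⟨χ, hχ⟩ := exists_monoidHom_circle_apply_ne_one hne'
    apply hχ
    have hχab : ((χ a : Circle) : ℂ) = ((χ b : Circle) : ℂ) := by
      have := DFunLike.congr_fun hab χ
      simpa [e] using this
    rw [map_mul, map_inv, mul_inv_eq_one]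
    exact Circle.ext hχab
  have hli := (linearIndependent_monoidHom (A →* Circle) ℂ).comp e he
  have hsum : ∑ a ∈ S, d a • ((fun f : (A →* Circle) →* ℂ => (f : (A →* Circle) → ℂ)) ∘ e) a = 0 := by
    funext χ
    simp only [Finset.sum_apply, Function.comp_apply, Pi.smul_apply, smul_eq_mul, Pi.zero_apply]
    have hχ := h (Circle.toUnits.comp χ) (fun b => by
      rw [MonoidHom.comp_apply, Circle.toUnits_apply, Units.val_mk0]; exact Circle.norm_coe _)
    simp only [MonoidHom.comp_apply, Circle.toUnits_apply, Units.val_mk0] at hχ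
    simpa [e, mul_comm] using hχ
  have hz := linearIndependent_iff'.mp hli S d hsum
  funext a
  by_cases ha : a ∈ S
  · exact hz a ha
  · exact Function.notMem_support.mp fun hmem => ha (hS hmem)

/-- **TWO FINITELY SUPPORTED FUNCTIONS WITH THE SAME CHARACTER SUMS AGAINST ALL UNITARY CHARACTERS ARE EQUAL.** [cite: HewittRoss1979, Thm. (23.11)] -/
theorem eq_of_forall_sum_char_mul_eq (d d' : A → ℂ) (S : Finset A) (hS : Function.support d ⊆ (S : Set A))
    (hS' : Function.support d' ⊆ (S : Set A))
    (h : ∀ χ : A →* ℂˣ, (∀ b, ‖((χ b : ℂˣ) : ℂ)‖ = 1) →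
      ∑ a ∈ S, ((χ a : ℂˣ) : ℂ) * d a = ∑ a ∈ S, ((χ a : ℂˣ) : ℂ) * d' a) :
    d = d' := by
  have hsub : (fun a => d a - d' a) = 0 := by
    refine eq_zero_of_forall_sum_char_mul_eq_zero _ S (fun a ha => ?_) (fun χ hχ => ?_)
    · by_contra hnot
      have hd : d a = 0 := Function.notMem_support.mp fun hm => hnot (hS hm)
      have hd' : d' a = 0 := Function.notMem_support.mp fun hm => hnot (hS' hm)
      exact ha (by simp only [hd, hd', sub_self])
    · simp only [mul_sub, Finset.sum_sub_distrib, h χ hχ, sub_self]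
  funext a
  exact sub_eq_zero.mp (congr_fun hsub a)

end Finsupp

/-! ### §3 Functions invariant under a compact open subgroup of an abelian topological group -/

section LocConst

variable {T : Type*} [Group T] [TopologicalSpace T] [ContinuousMul T]

/-- A function (into any type) that is invariant under RIGHT multiplication by an OPEN subgroup `C` is locally constant (it is constant on the open cosets `tC`).
[cite: HewittRoss1979, Thm. (23.11)] -/
theorem isLocallyConstant_of_forall_mul_mem_eq (C : Subgroup T) (hCo : IsOpen (C : Set T)) {Y : Type*} (F : T → Y)
    (hF : ∀ t, ∀ c ∈ C, F (t * c) = F t) : IsLocallyConstant F := by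
  rw [IsLocallyConstant.iff_exists_open]
  intro x
  refine ⟨(fun y => x⁻¹ * y) ⁻¹' (C : Set T), hCo.preimage (continuous_const_mul x⁻¹), ?_, fun y hy => ?_⟩
  · show x⁻¹ * x ∈ (C : Set T)
    rw [inv_mul_cancel]
    exact C.one_mem
  · have := hF x (x⁻¹ * y) hy
    rwa [mul_inv_cancel_left] at this

end LocConst

section Torus

variable {T : Type*} [CommGroup T] [TopologicalSpace T] [IsTopologicalGroup T] [MeasurableSpace T] [BorelSpace T]

/-- **F3 «TORUS-FOURIER-UNIQ».**  Let `T` be an abelian topological group, `C ≤ T` a compact open subgroup, `μ` a left-invariant measure on `T` that is positive on open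
sets and finite on compact sets (e.g. a Haar measure).  Let `Ψ, Ψ' : T → ℂ` be invariant under `C` (`Ψ(tc) = Ψ(t)`) with compact support.  If
`∫ χ·Ψ dμ = ∫ χ·Ψ' dμ` for every continuous, locally constant, UNITARY character `χ : T →* ℂˣ` trivial on `C`, then `Ψ = Ψ'`.  (Both functions descend to finitely
supported functions on the discrete group `T ⧸ C`; for `χ` trivial on `C`, `∫ χ·Ψ dμ = μ(C)·∑_{q ∈ T/C} χ(q)Ψ(q)` with `0 < μ(C) < ∞`; conclude by §2.)
[cite: HewittRoss1979, Thm. (23.11), Thm. (22.17)] -/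
theorem eq_of_forall_integral_char_mul_eq
    (μ : Measure T) [μ.IsMulLeftInvariant] [IsFiniteMeasureOnCompacts μ] [μ.IsOpenPosMeasure]
    (C : Subgroup T) (hCo : IsOpen (C : Set T)) (hCc : IsCompact (C : Set T))
    (Ψ Ψ' : T → ℂ) (hΨ : ∀ t, ∀ c ∈ C, Ψ (t * c) = Ψ t) (hΨ' : ∀ t, ∀ c ∈ C, Ψ' (t * c) = Ψ' t)
    (hK : HasCompactSupport Ψ) (hK' : HasCompactSupport Ψ')
    (h : ∀ χ : T →* ℂˣ, Continuous χ → IsLocallyConstant χ → (∀ c ∈ C, χ c = 1) → (∀ t, ‖((χ t : ℂˣ) : ℂ)‖ = 1) →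
      ∫ t, ((χ t : ℂˣ) : ℂ) * Ψ t ∂μ = ∫ t, ((χ t : ℂˣ) : ℂ) * Ψ' t ∂μ) :
    Ψ = Ψ' := by
  classical
  -- the difference `D` is `C`-invariant, compactly supported, locally constant
  set D : T → ℂ := fun t => Ψ t - Ψ' t with hDdef
  have hDinv : ∀ t, ∀ c ∈ C, D (t * c) = D t := fun t c hc => by
    simp only [hDdef, hΨ t c hc, hΨ' t c hc]
  have hDK : HasCompactSupport D := hK.sub hK'
  have hΨc : Continuous Ψ := (isLocallyConstant_of_forall_mul_mem_eq C hCo Ψ hΨ).continuous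
  have hΨ'c : Continuous Ψ' := (isLocallyConstant_of_forall_mul_mem_eq C hCo Ψ' hΨ').continuous
  suffices hzero : ∀ t, D t = 0 by
    funext t; exact sub_eq_zero.mp (hzero t)
  -- the quotient `A := T ⧸ C` and the descended function `d`
  let π : T →* T ⧸ C := QuotientGroup.mk' C
  have hπeq : ∀ x y : T, π x = π y ↔ x⁻¹ * y ∈ C := fun x y => QuotientGroup.eq
  have hπC : ∀ c ∈ C, π c = 1 := fun c hc => (QuotientGroup.eq_one_iff c).mpr hc
  let d : T ⧸ C → ℂ := fun q => D q.out
  have hd : ∀ t, d (π t) = D t := fun t => by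
    obtain ⟨c, hc⟩ := QuotientGroup.mk_out_eq_mul C t
    show D (Quotient.out (π t)) = D t
    rw [QuotientGroup.mk'_apply, hc]
    exact hDinv t c c.2
  -- the fibres of `π` are the cosets `tC`: open, of measure `μ C`
  have hfib : ∀ q : T ⧸ C, π ⁻¹' {q} = (fun y => (q.out)⁻¹ * y) ⁻¹' (C : Set T) := fun q => by
    ext y
    show π y = q ↔ (q.out)⁻¹ * y ∈ C
    have h1 : π q.out = q := QuotientGroup.out_eq' q
    rw [← hπeq, h1]
    exact eq_comm
  have hfibo : ∀ q : T ⧸ C, IsOpen (π ⁻¹' {q}) := fun q => by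
    rw [hfib q]; exact hCo.preimage (continuous_const_mul _)
  have hfibμ : ∀ q : T ⧸ C, μ.real (π ⁻¹' {q}) = μ.real (C : Set T) := fun q => by
    simp only [measureReal_def, hfib q, measure_preimage_mul]
  -- finitely many cosets cover the support
  obtain ⟨F, hF⟩ := IsCompact.elim_finite_subcover hDK (fun x : T => (fun y => x⁻¹ * y) ⁻¹' (C : Set T))
    (fun x => hCo.preimage (continuous_const_mul x⁻¹))
    (fun x _ => mem_iUnion.2 ⟨x, show x⁻¹ * x ∈ (C : Set T) by rw [inv_mul_cancel]; exact C.one_mem⟩)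
  let S : Finset (T ⧸ C) := F.image π
  have hsuppS : ∀ t, D t ≠ 0 → π t ∈ S := fun t ht => by
    have htK : t ∈ tsupport D := subset_tsupport D ht
    obtain ⟨x, hxF, hx⟩ : ∃ x ∈ F, t ∈ (fun y => x⁻¹ * y) ⁻¹' (C : Set T) := by
      simpa only [mem_iUnion, exists_prop] using hF htK
    rw [Finset.mem_image]
    exact ⟨x, hxF, (hπeq x t).mpr hx⟩
  have hdS : Function.support d ⊆ (S : Set (T ⧸ C)) := fun q hq => by
    have hq' : D q.out ≠ 0 := hq
    have := hsuppS q.out hq'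
    rwa [QuotientGroup.mk'_apply, QuotientGroup.out_eq'] at this
  -- `μ C` is positive and finite
  have hμC : μ.real (C : Set T) ≠ 0 :=
    (ENNReal.toReal_pos (hCo.measure_pos μ ⟨1, C.one_mem⟩).ne' hCc.measure_lt_top.ne).ne'
  -- the character sums of `d` vanish
  have hsum : ∀ χq : T ⧸ C →* ℂˣ, (∀ b, ‖((χq b : ℂˣ) : ℂ)‖ = 1) → ∑ q ∈ S, ((χq q : ℂˣ) : ℂ) * d q = 0 := by
    intro χq hχq
    let χ : T →* ℂˣ := χq.comp π
    have hχC : ∀ c ∈ C, χ c = 1 := fun c hc => by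
      show χq (π c) = 1
      rw [hπC c hc, map_one]
    have hχinv : ∀ t, ∀ c ∈ C, χ (t * c) = χ t := fun t c hc => by rw [map_mul, hχC c hc, mul_one]
    have hχlc : IsLocallyConstant χ := isLocallyConstant_of_forall_mul_mem_eq C hCo χ hχinv
    have hχcont : Continuous χ := hχlc.continuous
    have hχu : ∀ t, ‖((χ t : ℂˣ) : ℂ)‖ = 1 := fun t => hχq (π t)
    have hχval : Continuous fun t => ((χ t : ℂˣ) : ℂ) := Units.continuous_val.comp hχcont
    -- `∫ χ·D = 0`
    have hint : ∫ t, ((χ t : ℂˣ) : ℂ) * D t ∂μ = 0 := by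
      have hiΨ : Integrable (fun t => ((χ t : ℂˣ) : ℂ) * Ψ t) μ :=
        (hχval.mul hΨc).integrable_of_hasCompactSupport hK.mul_left
      have hiΨ' : Integrable (fun t => ((χ t : ℂˣ) : ℂ) * Ψ' t) μ :=
        (hχval.mul hΨ'c).integrable_of_hasCompactSupport hK'.mul_left
      have : (fun t => ((χ t : ℂˣ) : ℂ) * D t) = fun t => ((χ t : ℂˣ) : ℂ) * Ψ t - ((χ t : ℂˣ) : ℂ) * Ψ' t := by
        funext t; simp only [hDdef, mul_sub]
      rw [this, integral_sub hiΨ hiΨ', h χ hχcont hχlc hχC hχu, sub_self]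
    -- `∫ χ·D = μ(C) · ∑_{q ∈ S} χq(q) d(q)`
    have hzero_off : ∀ t, t ∉ (⋃ q ∈ S, π ⁻¹' {q}) → ((χ t : ℂˣ) : ℂ) * D t = 0 := fun t ht => by
      by_cases hDt : D t = 0
      · rw [hDt, mul_zero]
      · exact absurd (mem_iUnion₂.2 ⟨π t, hsuppS t hDt, rfl⟩) ht
    have hcalc : ∫ t, ((χ t : ℂˣ) : ℂ) * D t ∂μ = μ.real (C : Set T) * ∑ q ∈ S, ((χq q : ℂˣ) : ℂ) * d q := by
      rw [← setIntegral_eq_integral_of_forall_compl_eq_zero hzero_off]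
      rw [integral_biUnion_finset S (fun q _ => (hfibo q).measurableSet) ?_ ?_]
      · rw [Finset.mul_sum]
        refine Finset.sum_congr rfl fun q _ => ?_
        have hconst : ∀ t ∈ π ⁻¹' {q}, ((χ t : ℂˣ) : ℂ) * D t = ((χq q : ℂˣ) : ℂ) * d q := fun t ht => by
          have htq : π t = q := ht
          show ((χq (π t) : ℂˣ) : ℂ) * D t = _
          rw [htq, ← hd t, htq]
        rw [setIntegral_congr_fun (hfibo q).measurableSet hconst, setIntegral_const, hfibμ q, Complex.real_smul]
      · intro q _ q' _ hne
        exact (disjoint_singleton.2 hne).preimage π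
      · intro q _
        have hi : Integrable (fun t => ((χ t : ℂˣ) : ℂ) * D t) μ :=
          (hχval.mul (hΨc.sub hΨ'c)).integrable_of_hasCompactSupport hDK.mul_left
        exact hi.integrableOn
    have := hint
    rw [hcalc, mul_eq_zero] at this
    exact this.resolve_left (by exact_mod_cast hμC)
  -- conclude by §2 on the discrete group `T ⧸ C`
  have hd0 : d = 0 := eq_zero_of_forall_sum_char_mul_eq_zero d S hdS hsum
  intro t
  rw [← hd t, hd0, Pi.zero_apply]

end Torus

end Literature.MeasureTheory.Group

end
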